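/-
Copyright (c) 2026. All rights reserved.
Released under Apache 2.0 license as described in the file LICENSE.
-/
import Summits.ValiantsHypothesis.ValiantsHypothesis.Theorems.SuccinctTablesValiantCriterion
import Summits.ValiantsHypothesis.ValiantsHypothesis.Theorems.RoundCircuits
import HarnessLib

/-!
# The top-degree door: min-isolating the top homogeneous component suffices

Stage O-L2-18 (FILE 1 of 2) of the W4 isolation road ([cite: ForbesShpilkaVolk2018, §8]
dictionary, [cite: KlivansSpielman2001, Thm. 3] univariate trick). The door
`SuccinctTablesValiantCriterion.doorSpec_holds` wants small-circuit weights isolating a unique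
MINIMUM-weight monomial of the whole support of `D`; here it suffices to min-isolate a monomial of
the TOP HOMOGENEOUS COMPONENT of `D` (plus a `2^(n^e)` degree bound) — all cancellation caused by
constants in affine constructions lives in lower degree.
* §1 `isolationHit_of_forall_ne`: (E3) with `≠` in place of `<`.
* §2 the COMPLEMENT GADGET `complBits = [NOT w | B zeros | 1]` (`exists_circuit_compl`).
* §3 weight algebra and the UNIQUE MAXIMUM `uniqueMax_of_isolatesMin_top`.
* §4 the doors `hit_of_uniqueWeights` and `topDegreeDoor`, landing in `powPointSpec_holds` BY NAME.
Currency: kernel-certified helper for the W4 road; closes no item; ONE data def (`complBits`), no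
facts, no `Prop` definitions.
-/

noncomputable section

open MvPolynomial Finset

set_option linter.dupNamespace false

namespace Summit.ValiantsHypothesis.ValiantsHypothesis.Theorems.TopDegreeDoor

open Literature.Barriers.ValiantsHypothesis Literature.Computability.AlgebraicComplexity
  Literature.Computability.Complexity Literature.Computability.Complexity.GateList CircuitArith
  BoolGadgets SuccinctTables RoundCircuits

/-! ### §1 Unique-weight hitting: (E3) with `≠` in place of `<` -/

section UniqueWeight

variable {F : Type*} [Field F]

/-- A monomial whose weight VALUE is unique in `supp D` survives `c_μ ↦ t^{w μ}` (the proof of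
`isolationHit` uses only `≠`). [cite: KlivansSpielman2001, Thm. 3] -/
theorem isolationHit_of_forall_ne [Infinite F] {N : Type*} (w : N → ℕ) (D : MvPolynomial N F)
    (h : ∃ m₀ ∈ D.support, ∀ m ∈ D.support, m ≠ m₀ →
      (m.sum fun μ k => k * w μ) ≠ (m₀.sum fun μ k => k * w μ)) :
    ∃ t : F, eval (fun μ => t ^ w μ) D ≠ 0 := by
  classical
  obtain ⟨m₀, hm₀, hne⟩ := h
  set p := ∑ m ∈ D.support,
    Polynomial.C (coeff m D) * Polynomial.X ^ (m.sum fun μ k => k * w μ)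
  have hcoeff : p.coeff (m₀.sum fun μ k => k * w μ) = coeff m₀ D := by
    rw [Polynomial.finsetSum_coeff, Finset.sum_eq_single m₀]
    · rw [Polynomial.coeff_C_mul_X_pow, if_pos rfl]
    · intro m hm hmne; rw [Polynomial.coeff_C_mul_X_pow, if_neg (hne m hm hmne).symm]
    · intro h; exact absurd hm₀ h
  have hp0 : p ≠ 0 := fun h0 =>
    (mem_support_iff.1 hm₀) (by rw [← hcoeff, h0, Polynomial.coeff_zero])
  by_contra hall
  refine hp0 (Polynomial.funext fun t => ?_)
  rw [Polynomial.eval_zero, ← eval_pow_eq_eval_univ]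
  exact not_not.1 fun ht => hall ⟨t, ht⟩

end UniqueWeight

/-! ### §2 The complement gadget: bits `[NOT w | B zeros | 1]` -/

section Gadget

variable {ι : Type*}

/-- Bit vector `[¬ y | B zeros | 1]` (positions `< J`, then `J, …, J+B-1`, then `J+B`).
[folklore] -/
def complBits (J B : ℕ) (y : Fin J → Bool) : Fin (J + B + 1) → Bool :=
  fun i => if h : (i : ℕ) < J then !y ⟨i, h⟩ else decide ((i : ℕ) = J + B)

/-- Its binary value: `2^(J+B) + (2^J - 1 - ofBits y)`. [folklore] -/
theorem ofBits_complBits (J B : ℕ) (y : Fin J → Bool) :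
    Nat.ofBits (complBits J B y) = 2 ^ (J + B) + (2 ^ J - 1 - Nat.ofBits y) := by
  have hy : Nat.ofBits y < 2 ^ J := Nat.ofBits_lt_two_pow y
  have hJB : 2 ^ J ≤ 2 ^ (J + B) := Nat.pow_le_pow_right (by norm_num) (Nat.le_add_right J B)
  set x := 2 ^ J - 1 - Nat.ofBits y with hx
  have hx' : x = 2 ^ J - (Nat.ofBits y + 1) := by omega
  have hxlt : x < 2 ^ J := by omega
  refine Nat.eq_of_testBit_eq fun i => ?_
  rw [Nat.testBit_ofBits]
  rcases lt_trichotomy i (J + B) with hi | rfl | hi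
  · rw [Nat.testBit_two_pow_add_gt hi, hx', Nat.testBit_two_pow_sub_succ hy, Nat.testBit_ofBits,
      dif_pos (show i < J + B + 1 by omega)]
    unfold complBits
    by_cases hiJ : i < J
    · simp [hiJ]
    · simp [hiJ, hi.ne]
  · rw [Nat.testBit_two_pow_add_eq, Nat.testBit_lt_two_pow (lt_of_lt_of_le hxlt hJB),
      dif_pos (show J + B < J + B + 1 by omega)]
    unfold complBits
    simp [show ¬ (J + B < J) by omega]
  · have hlt : 2 ^ (J + B) + x < 2 ^ i :=
      calc 2 ^ (J + B) + x < 2 ^ (J + B) + 2 ^ (J + B) := by omega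
        _ = 2 ^ (J + B + 1) := by rw [pow_succ]; ring
        _ ≤ 2 ^ i := Nat.pow_le_pow_right (by norm_num) (by omega)
    rw [Nat.testBit_lt_two_pow hlt, dif_neg (show ¬ (i < J + B + 1) by omega)]

/-- One `NOT`/constant gate per output bit after the program for `f`. [cite: Vollmer1999, §1.2] -/
theorem cktSize_complBits (J B : ℕ) {s : ℕ} {f : (ι → Bool) → Fin J → Bool}
    (hf : CktSize B2 f s) : CktSize B2 (fun x => complBits J B (f x)) (s + (J + B + 1)) := by
  have h1 : ∀ i : Fin (J + B + 1),
      CktSize B2 (fun (y : Fin J → Bool) (_ : Unit) => complBits J B y i) 1 := by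
    intro i
    by_cases h : (i : ℕ) < J
    · exact (cktSize_not (ι := Fin J) ⟨i, h⟩).congr fun y _ => by simp [complBits, h]
    · exact (cktSize_const (Fin J) (decide ((i : ℕ) = J + B))).congr fun y _ => by
        simp [complBits, h]
  have h2 := CktSize.pi_const h1
  rw [Fintype.card_fin, mul_one] at h2
  exact hf.comp h2

/-- Designated gates of a `B₂`-circuit ARE a straight-line program of the same size (converse of
`RoundCircuits.exists_circuit_transcript`). [cite: Vollmer1999, Def. 1.6] -/
theorem cktSize_transcript (Q : Circuit ι) (hQ : Q.IsOver B2) {J : ℕ}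
    (out : Fin J → Fin Q.size) : CktSize B2 (fun x j => trueTranscript Q x (out j)) Q.size :=
  ⟨Q.gates, fun j => Sum.inr (out j), le_rfl, ⟨wf_gates Q, hQ,
    fun j m hm => by simp only [Sum.inr.injEq] at hm; subst hm; exact (out j).isLt,
    fun x j => (trueTranscript_eq_getD Q x (out j)).symm⟩⟩

/-- **Complemented weights are small-circuit weights**: `w' = 2^(J+B) + (2^J - 1 - w)`, read off
`J+B+1` gates of a circuit of size `≤ |Q| + 2(J+B+1)`. [cite: Vollmer1999, §1.2] -/
theorem exists_circuit_compl {n J : ℕ} (hn : 1 ≤ n) (Q : Circuit (Fin n × Fin (kBits n)))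
    (hQ : Q.IsOver B2) (out : Fin J → Fin Q.size) (B : ℕ) :
    ∃ (Q' : Circuit (Fin n × Fin (kBits n))) (out' : Fin (J + B + 1) → Fin Q'.size),
      Q'.IsOver B2 ∧ Q'.size ≤ Q.size + 2 * (J + B + 1) ∧
      ∀ μ, weightOf Q' out' μ = 2 ^ (J + B) + (2 ^ J - 1 - weightOf Q out μ) := by
  have h := cktSize_complBits J B (cktSize_transcript Q hQ out)
  obtain ⟨Q', out', hQ', hs', hval⟩ := exists_circuit_transcript
    ((⟨0, by omega⟩, ⟨0, by unfold kBits; omega⟩) : Fin n × Fin (kBits n)) h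
  refine ⟨Q', out', hQ', by omega, fun μ => ?_⟩
  unfold weightOf; rw [← ofBits_complBits]
  exact congrArg Nat.ofBits (funext fun j => hval _ j)

end Gadget

/-! ### §3 Weight algebra and the unique maximum -/

section Weights

variable {F : Type*} [Field F] {N : Type*}

/-- `Finsupp.degree` is the plain sum of the exponents (the form `totalDegree` uses). [folklore] -/
theorem degree_eq_sum_id (m : N →₀ ℕ) : m.degree = m.sum fun _ e => e := by
  rw [Finsupp.degree_apply]; rfl

/-- The weight read off `J` gates is `< 2^J`. [folklore] -/
theorem weightOf_lt {n J : ℕ} (Q : Circuit (Fin n × Fin (kBits n))) (out : Fin J → Fin Q.size)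
    (μ : degLEMonomials n) : weightOf Q out μ < 2 ^ J := by
  unfold weightOf; exact Nat.ofBits_lt_two_pow _

/-- `Σ_μ m(μ) w(μ) ≤ L · |m|` when `w ≤ L`. [folklore] -/
theorem sum_weight_le (w : N → ℕ) {L : ℕ} (hw : ∀ μ, w μ ≤ L) (m : N →₀ ℕ) :
    (m.sum fun μ k => k * w μ) ≤ L * m.degree := by
  rw [Finsupp.degree_apply, Finsupp.sum, Finset.mul_sum]
  exact Finset.sum_le_sum fun μ _ =>
    (Nat.mul_le_mul_left (m μ) (hw μ)).trans_eq (Nat.mul_comm _ _)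

/-- Complemented weights: `Σ m(μ)(L - w μ) + Σ m(μ) w μ = L · |m|`. [folklore] -/
theorem sum_compl_add (w : N → ℕ) {L : ℕ} (hw : ∀ μ, w μ ≤ L) (m : N →₀ ℕ) :
    (m.sum fun μ k => k * (L - w μ)) + (m.sum fun μ k => k * w μ) = L * m.degree := by
  rw [Finsupp.degree_apply, Finsupp.sum, Finsupp.sum, ← Finset.sum_add_distrib, Finset.mul_sum]
  refine Finset.sum_congr rfl fun μ _ => ?_
  show m μ * (L - w μ) + m μ * w μ = L * m μ
  rw [← Nat.mul_add, Nat.sub_add_cancel (hw μ), Nat.mul_comm]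

/-- A nonzero polynomial has a nonzero top homogeneous component. [folklore] -/
theorem homogeneousComponent_totalDegree_ne_zero (D : MvPolynomial N F) (hD : D ≠ 0) :
    homogeneousComponent D.totalDegree D ≠ 0 := by
  classical
  obtain ⟨m, hm, hdeg⟩ := Finset.exists_mem_eq_sup D.support (support_nonempty.2 hD)
    (fun s : N →₀ ℕ => s.sum fun _ e => e)
  have hmd : m.degree = D.totalDegree := by rw [degree_eq_sum_id]; exact hdeg.symm
  intro h0; have h1 := congrArg (coeff m) h0
  rw [coeff_homogeneousComponent, if_pos hmd, coeff_zero] at h1; exact (mem_support_iff.1 hm) h1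

/-- **Unique maximum.** If `w < 2^J` min-isolates `m₀` in the TOP component of `D` and
`deg D ≤ 2^B`, then under `w' = 2^(J+B) + (2^J - 1 - w)` the monomial `m₀` is the unique MAXIMUM
of all of `supp D` (`L = 2^(J+B) + 2^J - 1`: top monomials weigh `L·k - W(m)`, lower `≤ L(k-1)`).
[cite: KlivansSpielman2001, Thm. 3] -/
theorem uniqueMax_of_isolatesMin_top {J B : ℕ} (w : N → ℕ) (hw : ∀ μ, w μ < 2 ^ J)
    (D : MvPolynomial N F) (hk : D.totalDegree ≤ 2 ^ B)
    (h : IsolatesMin F w (homogeneousComponent D.totalDegree D))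
    (w' : N → ℕ) (hw' : ∀ μ, w' μ = 2 ^ (J + B) + (2 ^ J - 1 - w μ)) :
    ∃ m₀ ∈ D.support, ∀ m ∈ D.support, m ≠ m₀ →
      (m.sum fun μ k => k * w' μ) < (m₀.sum fun μ k => k * w' μ) := by
  classical
  set k := D.totalDegree
  set L := 2 ^ (J + B) + (2 ^ J - 1) with hL
  have hP : 1 ≤ 2 ^ J := Nat.one_le_two_pow; have hc : 1 ≤ 2 ^ (J + B) := Nat.one_le_two_pow
  have hwL : ∀ μ, w μ ≤ 2 ^ J - 1 := fun μ => by have := hw μ; omega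
  have hwL' : ∀ μ, w μ ≤ L := fun μ => by have := hwL μ; omega
  have hw'L : ∀ μ, w' μ = L - w μ := fun μ => by rw [hw', hL]; have := hwL μ; omega
  have hsum : ∀ m : N →₀ ℕ,
      (m.sum fun μ k => k * w' μ) + (m.sum fun μ k => k * w μ) = L * m.degree := by
    intro m
    have he : (m.sum fun μ k => k * w' μ) = (m.sum fun μ k => k * (L - w μ)) :=
      Finsupp.sum_congr fun μ _ => by rw [hw'L]
    rw [he]; exact sum_compl_add w hwL' m
  obtain ⟨m₀, hm₀, hmin⟩ := h
  rw [support_homogeneousComponent, Finset.mem_filter] at hm₀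
  obtain ⟨hm₀D, hd₀⟩ := hm₀
  refine ⟨m₀, hm₀D, fun m hm hne => ?_⟩
  have e0 := hsum m₀
  have e1 := hsum m
  have hW0 := sum_weight_le w hwL m₀
  rw [hd₀] at e0 hW0
  have hdm : m.degree ≤ k := by rw [degree_eq_sum_id]; exact le_totalDegree hm
  rcases hdm.eq_or_lt with hdk | hdk
  · have hm' : m ∈ (homogeneousComponent k D).support := by
      rw [support_homogeneousComponent, Finset.mem_filter]; exact ⟨hm, hdk⟩
    have hlt := hmin m hm' hne
    rw [hdk] at e1; omega
  · have hLd : L * m.degree + L ≤ L * k := by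
      rw [← Nat.mul_succ]; exact Nat.mul_le_mul_left L hdk
    have h1 : (2 ^ J - 1) * 2 ^ B + 2 ^ B = 2 ^ J * 2 ^ B := by
      rw [Nat.sub_one_mul, Nat.sub_add_cancel (Nat.le_mul_of_pos_left _ hP)]
    have h2 := pow_add 2 J B; have h3 : 1 ≤ 2 ^ B := Nat.one_le_two_pow
    have h4 : (2 ^ J - 1) * k ≤ (2 ^ J - 1) * 2 ^ B := Nat.mul_le_mul_left _ hk
    omega

/-- Door arithmetic: `s + 2(J + n^e + 1) ≤ 7 n^(c+e) ≤ n^(c+e+2)` for `n ≥ 3`. [folklore] -/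
theorem door_bounds {n c e s J : ℕ} (hn : 3 ≤ n) (hs : s ≤ n ^ c) (hJ : J ≤ n ^ c) :
    s + 2 * (J + n ^ e + 1) ≤ n ^ (c + e + 2) ∧ J + n ^ e + 1 ≤ n ^ (c + e + 2) := by
  have h1 : n ^ c ≤ n ^ (c + e) := Nat.pow_le_pow_right (by omega) (by omega)
  have h2 : n ^ e ≤ n ^ (c + e) := Nat.pow_le_pow_right (by omega) (by omega)
  have h3 : 1 ≤ n ^ (c + e) := Nat.one_le_pow _ _ (by omega)
  have h4 : 9 * n ^ (c + e) ≤ n ^ (c + e + 2) := by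
    rw [Nat.pow_add n (c + e) 2, Nat.mul_comm 9]; exact Nat.mul_le_mul_left _ (by nlinarith)
  constructor <;> omega

end Weights

/-! ### §4 The doors -/

section Doors

variable (F : Type*) [Field F]

/-- **Door with unique weight VALUES**: `doorSpec_holds` with `IsolatesMin` relaxed to "some
monomial of the support has a weight value attained only once" (E2 `powPointSpec_holds` + §1).
[cite: ForbesShpilkaVolk2018, §8] -/
theorem hit_of_uniqueWeights [CharZero F] [Infinite F]
    (𝒟 : (n : ℕ) → Set (MvPolynomial (degLEMonomials n) F)) {c : ℕ}
    (h : ∃ n₁ : ℕ, ∀ n : ℕ, n₁ ≤ n → ∀ D ∈ 𝒟 n, D ≠ 0 →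
      ∃ (J : ℕ) (Q : Circuit (Fin n × Fin (kBits n))) (out : Fin J → Fin Q.size),
        Q.IsOver B2 ∧ Q.size ≤ n ^ c ∧ J ≤ n ^ c ∧
        ∃ m₀ ∈ D.support, ∀ m ∈ D.support, m ≠ m₀ →
          (m.sum fun μ k => k * weightOf Q out μ) ≠
            (m₀.sum fun μ k => k * weightOf Q out μ)) :
    ∃ b n₀ : ℕ, ∀ n : ℕ, n₀ ≤ n →
      IsSuccinctHittingSet (degLEMonomials n) (SmallDefinable F n b) (𝒟 n) := by
  obtain ⟨n₁, hiso⟩ := h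
  obtain ⟨b, n₀, hpow⟩ := powPointSpec_holds (F := F) c
  refine ⟨b, max n₀ n₁, fun n hn D hD hD0 => ?_⟩
  obtain ⟨J, Q, out, hQ, hs, hJ, huniq⟩ := hiso n ((le_max_right _ _).trans hn) D hD hD0
  obtain ⟨t, ht⟩ := isolationHit_of_forall_ne (weightOf Q out) D huniq
  obtain ⟨g, hg, hcoeff⟩ := hpow n ((le_max_left _ _).trans hn) J Q out t hQ hs hJ
  have hv : coeffVector (degLEMonomials n) g = fun μ => t ^ weightOf Q out μ := funext hcoeff
  exact ⟨g, hg, by rw [hv]; exact ht⟩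

/-- **THE TOP-DEGREE DOOR.** Small-circuit MIN-isolating weights for the TOP HOMOGENEOUS COMPONENTS
of a family (plus a `2^(n^e)` degree bound) already give `VNP`-succinct hitting sets for the
family itself: complement the weights (§2), the isolated top monomial becomes the unique maximum of
the whole support (§3), and `hit_of_uniqueWeights` lands in `powPointSpec_holds` BY NAME.
[cite: ForbesShpilkaVolk2018, §8] -/
theorem topDegreeDoor [CharZero F] [Infinite F]
    (𝒟 : (n : ℕ) → Set (MvPolynomial (degLEMonomials n) F)) {c e : ℕ}
    (hiso : SmallIsolatingWeights F
      (fun n => (fun D => homogeneousComponent D.totalDegree D) '' 𝒟 n) c)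
    (hdeg : ∃ n₂, ∀ n, n₂ ≤ n → ∀ D ∈ 𝒟 n, D.totalDegree ≤ 2 ^ n ^ e) :
    ∃ b n₀ : ℕ, ∀ n : ℕ, n₀ ≤ n →
      IsSuccinctHittingSet (degLEMonomials n) (SmallDefinable F n b) (𝒟 n) := by
  obtain ⟨n₁, hiso⟩ := hiso; obtain ⟨n₂, hdeg⟩ := hdeg
  refine hit_of_uniqueWeights F 𝒟 (c := c + e + 2)
    ⟨max (max n₁ n₂) 3, fun n hn D hD hD0 => ?_⟩
  simp only [max_le_iff] at hn
  obtain ⟨⟨hn₁, hn₂⟩, hn3⟩ := hn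
  obtain ⟨J, Q, out, hQ, hs, hJ, hmin⟩ := hiso n hn₁ _ (Set.mem_image_of_mem _ hD)
    (homogeneousComponent_totalDegree_ne_zero D hD0)
  obtain ⟨Q', out', hQ', hs', hval⟩ := exists_circuit_compl (by omega) Q hQ out (n ^ e)
  obtain ⟨hb1, hb2⟩ := door_bounds (e := e) hn3 hs hJ
  obtain ⟨m₀, hm₀, hmax⟩ := uniqueMax_of_isolatesMin_top (F := F) (weightOf Q out)
    (weightOf_lt Q out) D (hdeg n hn₂ D hD) hmin (weightOf Q' out') hval
  exact ⟨J + n ^ e + 1, Q', out', hQ', hs'.trans hb1, hb2, m₀, hm₀,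
    fun m hm hne => (hmax m hm hne).ne⟩

end Doors

end Summit.ValiantsHypothesis.ValiantsHypothesis.Theorems.TopDegreeDoor

end
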